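import Summits.CriticalPhenomena.SAWScalingLimit.Theorems.SAWDefectDecoherenceBoundaryClosureRBoundaryDataTransferFloorValue
import Summits.CriticalPhenomena.SAWScalingLimit.Theorems.SAWDefectDecoherenceBoundaryClosureRPickEngineStage2
import HarnessLib

/-!
# Boundary data transfer, III: the arms and the root wedge in the limit

Route `SAWDefectDecoherence`, crux `BoundaryClosureR` (stmt-CriticalPhenomena-14004), line
`pick-half-plane`, stub `stub_engineBoundaryData` (r13): hypotheses (I1)+(I2) of the landed
`pickEngine_stage2` for every engine limit `h`, on the half-disc of radius `r/4` at the root.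
`arm_lines_at`/`arm_lines`: for the winding class `j₀ mod 8` hit frequently along the mesh sequence,
the differences of `h` along the east ray lie on `e^{iθ}ℝ`, `θ = π/8 − (3/8)(π + 2πj₀)`, along the
west ray on `e^{i(θ−π/4)}ℝ` (exact lattice arms at the floor sites, `floorSite_value`, closedness).
`wedge_at`/`wedge_limit`: the lattice wedge `RootWedgeBound` passes to `−M ≤ Re(conj ω · h)`,
`ω = −e^{i(5/8)(π + 2πj₀)}`.  `arms_wedge`: (I1)+(I2) assembled (arms through one point `p`, rigid
compatibility `ω e^{−iθ} = e^{−iπ/8}`).  Registered piece: `boundaryDataTransfer_westPhaseClass`.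
-/

noncomputable section

open scoped Topology
open Filter Set
open Complex (I exp)
open Literature.Probability.LatticeModels Literature.Probability.RandomPlanarGeometry
open Literature.Probability.RandomPlanarGeometry.SAW
open Summit.CriticalPhenomena.SAWScalingLimit.Theorems.PickHalfPlane.RootWedge
open Summit.CriticalPhenomena.SAWScalingLimit.Theorems.PickHalfPlane.DevelopingMaps
open Summit.CriticalPhenomena.SAWScalingLimit.Theorems.PickHalfPlane.BoundaryExactness

namespace Summit.CriticalPhenomena.SAWScalingLimit.Theorems.PickHalfPlane.BoundaryDataTransfer

/-- The west phase depends on the class mod 8 only (`phase_eq_of_class` shifted by `−π/4`).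
[folklore] -/
theorem westPhase_eq_of_class {j j' : ℤ} (h : (j : ZMod 8) = (j' : ZMod 8)) :
    exp (((Real.pi / 8 - 3 / 8 * (Real.pi + 2 * Real.pi * j) - Real.pi / 4 : ℝ) : ℂ) * I) =
      exp (((Real.pi / 8 - 3 / 8 * (Real.pi + 2 * Real.pi * j') - Real.pi / 4 : ℝ) : ℂ) * I) := by
  have e : ∀ W : ℝ, exp (((Real.pi / 8 - 3 / 8 * W - Real.pi / 4 : ℝ) : ℂ) * I) =
      exp (((Real.pi / 8 - 3 / 8 * W : ℝ) : ℂ) * I) * exp (((-(Real.pi / 4) : ℝ) : ℂ) * I) := by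
    intro W; rw [← Complex.exp_add]; congr 1; push_cast; ring
  rw [e, e, phase_eq_of_class h]

/-- **Registered helper `boundaryDataTransfer_westPhaseClass`** (crux stmt-CriticalPhenomena-14004,
line `pick-half-plane`, stub `stub_engineBoundaryData`): the west-arm phase depends on the winding
class mod 8 only, ∀-closed (`westPhase_eq_of_class`). [folklore] -/
theorem boundaryDataTransfer_westPhaseClass : ∀ (j j' : ℤ), (j : ZMod 8) = (j' : ZMod 8) → Complex.exp (((Real.pi / 8 - 3 / 8 * (Real.pi + 2 * Real.pi * j) - Real.pi / 4 : ℝ) : ℂ) * Complex.I) = Complex.exp (((Real.pi / 8 - 3 / 8 * (Real.pi + 2 * Real.pi * j') - Real.pi / 4 : ℝ) : ℂ) * Complex.I) :=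
  fun _ _ h => westPhase_eq_of_class h

/-- **The arm lines at one scale.**  At a scale of the root frame with a walk `root → normaliser` of
winding `π + 2πj`, `j ≡ j₀ (mod 8)`: if the floor-site values under two points `z, z'` of the root
piece on the SAME side of `x` (both east, or both west, by `ε_f + δ` at least, within `r/2`) are
within `ε/2` of `h z`, `h z'`, then `h z − h z'` is within `ε` of the line `e^{iθ}ℝ` (east,
`θ = π/8 − (3/8)(π + 2πj₀)`) resp. `e^{i(θ−π/4)}ℝ` (west) — `east_cols_diff` / `west_cols_diff`.
[cite: DuminilCopinSmirnov2012, §4 (the map H with dH = F dz)] -/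
theorem arm_lines_at {Λ : Finset HexVertex} (hΛ : hexDomainSimplyConnected Λ) {δ r : ℝ} (hδ0 : 0 < δ)
    (hδr : δ ≤ r / 4) {x z z' : ℂ} {M ka kb mb j j₀ : ℤ} {εf ε : ℝ} {ee bb : Sym2 HexVertex}
    (he : ee = floorEdge ka M) (hb : bb = floorEdge kb mb) (hUb : upFace kb mb ∈ Λ) (hBb : belowFace kb mb ∉ Λ)
    (hneb : floorEdge kb mb ≠ floorEdge ka M) (γb : HexMidEdgeSAW Λ (floorEdge ka M) (floorEdge kb mb))
    (hwind : γb.winding = Real.pi + 2 * Real.pi * j) (hclass : (j : ZMod 8) = (j₀ : ZMod 8))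
    (hnear : ‖(δ : ℂ) * hexMidpoint ee - x‖ < εf) (hεf : εf ≤ r / 8)
    (hW : ∀ k : ℤ, |δ * (k + M / 2) - x.re| ≤ 3 * r / 4 →
      upFace k M ∈ Λ ∧ belowFace k M ∉ Λ ∧ ((![k, M], 1) : HexVertex) ∈ Λ ∧ ((![k - 1, M], 1) : HexVertex) ∈ Λ)
    {H : Site 2 → ℂ} (hH : IsPotential Λ ee H) {sb : Site 2} {h : ℂ → ℂ}
    (hzx : |z.re - x.re| < r / 2) (hz'x : |z'.re - x.re| < r / 2)
    (hva : ‖(δ : ℂ) * (H ![⌊z.re / δ - M / 2⌋, M] - H sb) /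
      hexParafermionicObservable Λ ee hexCriticalFugacity (5 / 8) bb - h z‖ ≤ ε / 2)
    (hva' : ‖(δ : ℂ) * (H ![⌊z'.re / δ - M / 2⌋, M] - H sb) /
      hexParafermionicObservable Λ ee hexCriticalFugacity (5 / 8) bb - h z'‖ ≤ ε / 2) :
    (x.re + εf + δ < z.re → x.re + εf + δ < z'.re → ∃ t : ℝ,
      ‖h z - h z' - exp (((Real.pi / 8 - 3 / 8 * (Real.pi + 2 * Real.pi * j₀) : ℝ) : ℂ) * I) * t‖ ≤ ε) ∧
    (z.re + εf + δ < x.re → z'.re + εf + δ < x.re → ∃ t : ℝ,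
      ‖h z - h z' - exp (((Real.pi / 8 - 3 / 8 * (Real.pi + 2 * Real.pi * j₀) - Real.pi / 4 : ℝ) : ℂ) * I) * t‖
        ≤ ε) := by
  obtain ⟨⟨hka₁, hka₂⟩, ⟨ha₁, ha₂⟩, hka_a, ha_ka⟩ := rootColumns hδ0 hδr he hnear hεf hzx
  obtain ⟨-, ⟨ha'₁, ha'₂⟩, hka_a', ha'_ka⟩ := rootColumns hδ0 hδr he hnear hεf hz'x
  have hF := flat_of_window hδ0 hW
  have hH' : IsPotential Λ (floorEdge ka M) H := by rw [← he]; exact hH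
  set Fb := hexParafermionicObservable Λ ee hexCriticalFugacity (5 / 8) bb with hFb
  have hobs : Fb = hexParafermionicObservable Λ (floorEdge ka M) hexCriticalFugacity (5 / 8) (floorEdge kb mb) := by
    rw [hFb, he, hb]
  -- the common estimate, for any phase `u`
  have key : ∀ (u : ℂ) (t : ℝ), (H ![⌊z.re / δ - M / 2⌋, M] - H ![⌊z'.re / δ - M / 2⌋, M]) /
      hexParafermionicObservable Λ (floorEdge ka M) hexCriticalFugacity (5 / 8) (floorEdge kb mb) = u * t →
      ‖h z - h z' - u * ((δ * t : ℝ) : ℂ)‖ ≤ ε := by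
    intro u t ht
    have e1 : h z - h z' - u * ((δ * t : ℝ) : ℂ) =
        -((δ : ℂ) * (H ![⌊z.re / δ - M / 2⌋, M] - H sb) / Fb - h z) +
          ((δ : ℂ) * (H ![⌊z'.re / δ - M / 2⌋, M] - H sb) / Fb - h z') +
          ((δ : ℂ) * ((H ![⌊z.re / δ - M / 2⌋, M] - H ![⌊z'.re / δ - M / 2⌋, M]) /
            hexParafermionicObservable Λ (floorEdge ka M) hexCriticalFugacity (5 / 8) (floorEdge kb mb)) -
            u * ((δ * t : ℝ) : ℂ)) := by
      rw [hobs]; push_cast; ring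
    rw [e1, ht, show (δ : ℂ) * (u * t) - u * ((δ * t : ℝ) : ℂ) = 0 by push_cast; ring, add_zero]
    calc ‖-((δ : ℂ) * (H ![⌊z.re / δ - M / 2⌋, M] - H sb) / Fb - h z) +
          ((δ : ℂ) * (H ![⌊z'.re / δ - M / 2⌋, M] - H sb) / Fb - h z')‖
        ≤ ‖-((δ : ℂ) * (H ![⌊z.re / δ - M / 2⌋, M] - H sb) / Fb - h z)‖ +
          ‖(δ : ℂ) * (H ![⌊z'.re / δ - M / 2⌋, M] - H sb) / Fb - h z'‖ := norm_add_le _ _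
      _ ≤ ε / 2 + ε / 2 := by rw [norm_neg]; exact add_le_add hva hva'
      _ = ε := add_halves ε
  constructor
  · intro hxz hxz'
    obtain ⟨t, ht⟩ := east_cols_diff hΛ hF hka₁ hka₂ hUb hBb hneb γb hH' (hka_a hxz) (by omega)
      (hka_a' hxz') (by omega)
    rw [hwind, phase_eq_of_class hclass] at ht
    exact ⟨δ * t, key _ t ht⟩
  · intro hzx₀ hz'x₀
    obtain ⟨t, ht⟩ := west_cols_diff hΛ hF hka₁ hka₂ hUb hBb hneb γb hH' ha₁ (ha_ka hzx₀).le ha'₁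
      (ha'_ka hz'x₀).le
    rw [hwind, westPhase_eq_of_class hclass] at ht
    exact ⟨δ * t, key _ t ht⟩


/-- **The wedge at one scale.**  At a scale of the root frame with a walk `root → normaliser` of
winding `π + 2πj`, `j ≡ j₀ (mod 8)`: the lattice wedge bound `δ(Re H s − Re H s_b) ≤ M_w Z_b`
(`RootWedgeBound`) and `‖h_δ(s) − h z‖ ≤ ε` give `−M_w − ε ≤ Re(conj ω · h z)` for the class
direction `ω = −e^{i(5/8)(π + 2πj₀)}` (`rootFrame_wedge`, `omega_eq_of_class`).
[cite: DuminilCopinSmirnov2012, §4 (the map H with dH = F dz)] -/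
theorem wedge_at {Λ : Finset HexVertex} (hΛ : hexDomainSimplyConnected Λ) {δ : ℝ} {z : ℂ}
    {M ka kb mb j j₀ : ℤ} {Mw ε : ℝ} {ee bb : Sym2 HexVertex}
    (he : ee = floorEdge ka M) (hb : bb = floorEdge kb mb) (hUa : upFace ka M ∈ Λ) (hBa : belowFace ka M ∉ Λ)
    (hUb : upFace kb mb ∈ Λ) (hBb : belowFace kb mb ∉ Λ)
    (hneb : floorEdge kb mb ≠ floorEdge ka M) (γb : HexMidEdgeSAW Λ (floorEdge ka M) (floorEdge kb mb))
    (hwind : γb.winding = Real.pi + 2 * Real.pi * j) (hclass : (j : ZMod 8) = (j₀ : ZMod 8))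
    {H : Site 2 → ℂ} {s sb : Site 2} {h : ℂ → ℂ}
    (hM : δ * ((H s).re - (H sb).re) ≤ Mw * ‖hexParafermionicObservable Λ ee hexCriticalFugacity 0 bb‖)
    (hva : ‖(δ : ℂ) * (H s - H sb) / hexParafermionicObservable Λ ee hexCriticalFugacity (5 / 8) bb - h z‖ ≤ ε) :
    -Mw - ε ≤ ((starRingEnd ℂ) (-exp (I * (5 / 8 : ℂ) * ((Real.pi + 2 * Real.pi * j₀ : ℝ) : ℂ))) * h z).re := by
  rw [he, hb] at hM hva
  have hw := rootFrame_wedge hΛ hUa hBa hUb hBb hneb γb hM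
  rw [hwind, omega_eq_of_class hclass] at hw
  set ω : ℂ := -exp (I * (5 / 8 : ℂ) * ((Real.pi + 2 * Real.pi * j₀ : ℝ) : ℂ)) with hω
  set v : ℂ := (δ : ℂ) * (H s - H sb) /
    hexParafermionicObservable Λ (floorEdge ka M) hexCriticalFugacity (5 / 8) (floorEdge kb mb) with hv
  have hωn : ‖(starRingEnd ℂ) ω‖ = 1 := by
    rw [Complex.norm_conj, hω, norm_neg, show I * (5 / 8 : ℂ) * ((Real.pi + 2 * Real.pi * j₀ : ℝ) : ℂ) =
      ((5 / 8 * (Real.pi + 2 * Real.pi * j₀) : ℝ) : ℂ) * I by push_cast; ring, Complex.norm_exp_ofReal_mul_I]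
  have h1 : ((starRingEnd ℂ) ω * h z).re = ((starRingEnd ℂ) ω * v).re + ((starRingEnd ℂ) ω * (h z - v)).re := by
    rw [← Complex.add_re]; ring_nf
  have h2 : |((starRingEnd ℂ) ω * (h z - v)).re| ≤ ε := by
    refine (Complex.abs_re_le_norm _).trans ?_
    rw [norm_mul, hωn, one_mul, norm_sub_rev]; exact hva
  rw [h1]
  linarith [(abs_le.1 h2).1]


section Frame

variable {D : DobrushinDomain} {ρ : ℝ} {Λ : ℝ → Finset HexVertex} {m : ℝ → ℤ} {b : ℝ → Sym2 HexVertex}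
  (hAF : 0 < ρ ∧
    D.carrier ∩ Metric.ball (D.pt 1) ρ = {z : ℂ | (D.pt 1).im < z.im} ∩ Metric.ball (D.pt 1) ρ ∧
    (∀ᶠ δ : ℝ in 𝓝[>] 0, hexDomainSimplyConnected (Λ δ) ∧ b δ ∈ hexDomainBoundary (Λ δ) ∧
      (hexGraph.induce ((Λ δ : Finset HexVertex) : Set HexVertex)).Preconnected ∧
      (∀ v ∈ Λ δ, (δ : ℂ) * hexCenter v ∈ D.carrier) ∧
      (∀ v : HexVertex, (δ : ℂ) * hexCenter v ∈ Metric.ball (D.pt 1) ρ →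
        (v ∈ Λ δ ↔ m δ ≤ v.1 1))) ∧
    (∀ K : Set ℂ, IsCompact K → K ⊆ D.carrier →
      ∀ᶠ δ : ℝ in 𝓝[>] 0, ∀ v : HexVertex, (δ : ℂ) * hexCenter v ∈ K → v ∈ Λ δ) ∧
    Tendsto (fun δ : ℝ => (δ : ℂ) * hexMidpoint (b δ)) (𝓝[>] 0) (𝓝 (D.pt 1)))
  {x : ℂ} {e : ℝ → Sym2 HexVertex} {r : ℝ} {mr : ℝ → ℤ}
  (hPR : 0 < r ∧ D.carrier ∩ Metric.ball x r = {z : ℂ | x.im < z.im} ∩ Metric.ball x r ∧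
    (∀ᶠ δ : ℝ in 𝓝[>] 0, e δ ∈ hexDomainBoundary (Λ δ) ∧
      Nonempty (HexMidEdgeSAW (Λ δ) (e δ) (b δ)) ∧
      (∀ v : HexVertex, (δ : ℂ) * hexCenter v ∈ Metric.ball x r → (v ∈ Λ δ ↔ mr δ ≤ v.1 1))) ∧
    Tendsto (fun δ : ℝ => (δ : ℂ) * hexMidpoint (e δ)) (𝓝[>] 0) (𝓝 x))
  (hx : x ≠ D.pt 1)
  (hSup : ∀ K : Set ℂ, IsCompact K →
    K ⊆ D.carrier ∪ (({z : ℂ | z.im = (D.pt 1).im} ∩ Metric.ball (D.pt 1) ρ) ∪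
      ({z : ℂ | z.im = x.im} ∩ Metric.ball x r)) → x ∉ K →
    ∃ C : ℝ, ∀ᶠ δ : ℝ in 𝓝[>] 0, ∀ z ∈ hexDomainMidEdges (Λ δ), (δ : ℂ) * hexMidpoint z ∈ K →
      ‖hexParafermionicObservable (Λ δ) (e δ) hexCriticalFugacity (5 / 8) z‖ ≤
        C * ‖hexParafermionicObservable (Λ δ) (e δ) hexCriticalFugacity (5 / 8) (b δ)‖)
  {ns : ℕ → ℝ} (hns : Tendsto ns atTop (𝓝[>] 0)) {h : ℂ → ℂ}
  (hcont : ContinuousOn h ((D.carrier ∪ (({z : ℂ | z.im = (D.pt 1).im} ∩ Metric.ball (D.pt 1) ρ) ∪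
    ({z : ℂ | z.im = x.im} ∩ Metric.ball x r))) \ {x}))
  (hconv : ∀ K : Set ℂ, IsCompact K →
    K ⊆ (D.carrier ∪ (({z : ℂ | z.im = (D.pt 1).im} ∩ Metric.ball (D.pt 1) ρ) ∪
      ({z : ℂ | z.im = x.im} ∩ Metric.ball x r))) \ {x} →
    ∀ ε : ℝ, 0 < ε → ∀ᶠ n : ℕ in atTop, ∀ H : Site 2 → ℂ, IsPotential (Λ (ns n)) (e (ns n)) H →
      ∀ (ub wb : HexVertex), b (ns n) = s(ub, wb) →
      ∀ sb : Site 2, sb ∈ hexFaceVertices ub → sb ∈ hexFaceVertices wb →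
      ∀ s : Site 2, IsLatticeSite (Λ (ns n)) s → ((ns n : ℝ) : ℂ) * triEmbed s ∈ K →
        ‖((ns n : ℝ) : ℂ) * (H s - H sb) /
              hexParafermionicObservable (Λ (ns n)) (e (ns n)) hexCriticalFugacity (5 / 8) (b (ns n)) -
            h (((ns n : ℝ) : ℂ) * triEmbed s)‖ < ε)

include hAF hPR hx hSup hns hcont hconv

/-- **The arm lines in the limit.**  For the winding class `j₀` hit frequently along the sequence
and two points `z, z'` of the root piece within `r/2` of `x`: if both lie east of `x` then
`Im(e^{−iθ}(h z − h z')) = 0`, `θ = π/8 − (3/8)(π + 2πj₀)`; if both lie west then the same with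
`θ − π/4` (`arm_lines_at` at a good scale, `floorSite_value`, closedness of lines).
[cite: DuminilCopinSmirnov2012, §4 (the map H with dH = F dz)] -/
theorem arm_lines {j₀ : ℤ}
    (hcl : ∃ᶠ n : ℕ in atTop, ∃ (ka kb j : ℤ)
      (γb : HexMidEdgeSAW (Λ (ns n)) (floorEdge ka (mr (ns n))) (floorEdge kb (m (ns n)))),
      e (ns n) = floorEdge ka (mr (ns n)) ∧ b (ns n) = floorEdge kb (m (ns n)) ∧
      upFace ka (mr (ns n)) ∈ Λ (ns n) ∧ belowFace ka (mr (ns n)) ∉ Λ (ns n) ∧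
      upFace kb (m (ns n)) ∈ Λ (ns n) ∧ belowFace kb (m (ns n)) ∉ Λ (ns n) ∧
      floorEdge kb (m (ns n)) ≠ floorEdge ka (mr (ns n)) ∧
      γb.winding = Real.pi + 2 * Real.pi * j ∧ (j : ZMod 8) = (j₀ : ZMod 8))
    {z z' : ℂ} (hzim : z.im = x.im) (hz'im : z'.im = x.im) (hzx : z.re ≠ x.re) (hz'x : z'.re ≠ x.re)
    (hzr : ‖z - x‖ < r / 2) (hz'r : ‖z' - x‖ < r / 2) :
    (x.re < z.re → x.re < z'.re →
      (exp (-(((Real.pi / 8 - 3 / 8 * (Real.pi + 2 * Real.pi * j₀) : ℝ) : ℂ) * I)) * (h z - h z')).im = 0) ∧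
    (z.re < x.re → z'.re < x.re →
      (exp (-(((Real.pi / 8 - 3 / 8 * (Real.pi + 2 * Real.pi * j₀) - Real.pi / 4 : ℝ) : ℂ) * I)) *
        (h z - h z')).im = 0) := by
  obtain ⟨hr, hcarx, hevx, helim⟩ := hPR
  have hU : ∀ {w : ℂ}, w.im = x.im → w.re ≠ x.re → ‖w - x‖ < r / 2 →
      w ∈ (D.carrier ∪ (({z : ℂ | z.im = (D.pt 1).im} ∩ Metric.ball (D.pt 1) ρ) ∪
        ({z : ℂ | z.im = x.im} ∩ Metric.ball x r))) \ {x} := fun hwim hwx hwr =>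
    ⟨Or.inr (Or.inr ⟨hwim, by rw [Metric.mem_ball, dist_eq_norm]; linarith⟩),
      fun hw => hwx (by rw [show _ = x from hw])⟩
  have hpin := hevx.mono fun _ h => h.2.2
  have hbd := hevx.mono fun _ h => h.1
  have habs : ∀ {w : ℂ}, ‖w - x‖ < r / 2 → |w.re - x.re| < r / 2 := fun {w} hw => by
    have := Complex.abs_re_le_norm (w - x); rw [Complex.sub_re] at this; exact lt_of_le_of_lt this hw
  -- the good scales, for every `ε`
  have main : ∀ ε : ℝ, 0 < ε → ∃ (n : ℕ) (δ : ℝ) (ka kb j : ℤ) (εf : ℝ)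
      (γb : HexMidEdgeSAW (Λ δ) (floorEdge ka (mr δ)) (floorEdge kb (m δ))) (H : Site 2 → ℂ) (sb : Site 2),
      δ = ns n ∧ hexDomainSimplyConnected (Λ δ) ∧ 0 < δ ∧ δ ≤ r / 4 ∧ δ < εf ∧
      e δ = floorEdge ka (mr δ) ∧ b δ = floorEdge kb (m δ) ∧ upFace kb (m δ) ∈ Λ δ ∧ belowFace kb (m δ) ∉ Λ δ ∧
      floorEdge kb (m δ) ≠ floorEdge ka (mr δ) ∧ γb.winding = Real.pi + 2 * Real.pi * j ∧
      (j : ZMod 8) = (j₀ : ZMod 8) ∧ ‖(δ : ℂ) * hexMidpoint (e δ) - x‖ < εf ∧ εf ≤ r / 8 ∧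
      8 * εf ≤ |z.re - x.re| ∧ 8 * εf ≤ |z'.re - x.re| ∧
      (∀ k : ℤ, |δ * (k + mr δ / 2) - x.re| ≤ 3 * r / 4 → upFace k (mr δ) ∈ Λ δ ∧ belowFace k (mr δ) ∉ Λ δ ∧
        ((![k, mr δ], 1) : HexVertex) ∈ Λ δ ∧ ((![k - 1, mr δ], 1) : HexVertex) ∈ Λ δ) ∧
      IsPotential (Λ δ) (e δ) H ∧
      ‖(δ : ℂ) * (H ![⌊z.re / δ - mr δ / 2⌋, mr δ] - H sb) /
        hexParafermionicObservable (Λ δ) (e δ) hexCriticalFugacity (5 / 8) (b δ) - h z‖ ≤ ε / 2 ∧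
      ‖(δ : ℂ) * (H ![⌊z'.re / δ - mr δ / 2⌋, mr δ] - H sb) /
        hexParafermionicObservable (Λ δ) (e δ) hexCriticalFugacity (5 / 8) (b δ) - h z'‖ ≤ ε / 2 := by
    intro ε hε
    have hv := floorSite_value hAF ⟨hr, hcarx, hevx, helim⟩ hx hSup hns hcont hconv hr hcarx hpin hbd helim
      (hU hzim hzx hzr) hzim (by linarith) (half_pos hε)
    have hv' := floorSite_value hAF ⟨hr, hcarx, hevx, helim⟩ hx hSup hns hcont hconv hr hcarx hpin hbd helim
      (hU hz'im hz'x hz'r) hz'im (by linarith) (half_pos hε)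
    set εf : ℝ := min (min |z.re - x.re| |z'.re - x.re|) r / 8 with hεf
    have hminf : 0 < min (min |z.re - x.re| |z'.re - x.re|) r :=
      lt_min (lt_min (abs_pos.2 (sub_ne_zero.2 hzx)) (abs_pos.2 (sub_ne_zero.2 hz'x))) hr
    have hεf0 : 0 < εf := by positivity
    have hεfz : 8 * εf ≤ |z.re - x.re| := by
      have := (min_le_left _ r).trans (min_le_left |z.re - x.re| |z'.re - x.re|); rw [hεf]; linarith
    have hεfz' : 8 * εf ≤ |z'.re - x.re| := by
      have := (min_le_left _ r).trans (min_le_right |z.re - x.re| |z'.re - x.re|); rw [hεf]; linarith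
    have hεfr : 8 * εf ≤ r := by have := min_le_right (min |z.re - x.re| |z'.re - x.re|) r; rw [hεf]; linarith
    have hnear := rootFrame_near ⟨hr, hcarx, hevx, helim⟩ (hAF.2.2.1.mono fun _ h => h.2.2.2.1) hεf0
    have hW := flat_window (R' := 3 * r / 4) (by linarith) hpin hbd helim
    have hδev : ∀ᶠ δ : ℝ in 𝓝[>] 0, δ ∈ Set.Ioo 0 εf := Ioo_mem_nhdsGT hεf0
    obtain ⟨n, ⟨ka, kb, j, γb, he, hb, _, _, hUb, hBb, hneb, hwind, hclass⟩, hvn, hv'n, ⟨hne, _, _⟩,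
      hWn, ⟨hδ0, hδε⟩, hsc, hbdn⟩ :=
      (hcl.and_eventually (hv.and (hv'.and ((hns.eventually hnear).and ((hns.eventually hW).and
        ((hns.eventually hδev).and ((hns.eventually (hAF.2.2.1.mono fun _ h => h.1)).and
          (hns.eventually hbd)))))))).exists
    obtain ⟨H, hH⟩ := potentialExists_proof (Λ (ns n)) hsc (e (ns n)) hbdn
    have hb' : b (ns n) = s(belowFace kb (m (ns n)), upFace kb (m (ns n))) := hb
    obtain ⟨_, _, hva⟩ := hvn H hH _ _ hb' _ (floorSite_mem_belowFace kb (m (ns n)))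
      (floorSite_mem_upFace kb (m (ns n)))
    obtain ⟨_, _, hva'⟩ := hv'n H hH _ _ hb' _ (floorSite_mem_belowFace kb (m (ns n)))
      (floorSite_mem_upFace kb (m (ns n)))
    exact ⟨n, ns n, ka, kb, j, εf, γb, H, ![kb, m (ns n)], rfl, hsc, hδ0, by linarith, hδε, he, hb, hUb, hBb, hneb,
      hwind, hclass, hne, by linarith, hεfz, hεfz', hWn, hH, hva, hva'⟩
  constructor
  · intro hxz hxz'
    apply im_rot_eq_zero_of_forall_approx
    intro ε hε
    obtain ⟨n, δ, ka, kb, j, εf, γb, H, sb, -, hsc, hδ0, hδr, hδε, he, hb, hUb, hBb, hneb, hwind, hclass, hne, hεfr,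
      hεfz, hεfz', hWn, hH, hva, hva'⟩ := main ε hε
    rw [abs_of_pos (sub_pos.2 hxz)] at hεfz
    rw [abs_of_pos (sub_pos.2 hxz')] at hεfz'
    exact (arm_lines_at hsc hδ0 hδr he hb hUb hBb hneb γb hwind hclass hne hεfr hWn hH (habs hzr) (habs hz'r)
      hva hva').1 (by linarith) (by linarith)
  · intro hxz hxz'
    apply im_rot_eq_zero_of_forall_approx
    intro ε hε
    obtain ⟨n, δ, ka, kb, j, εf, γb, H, sb, -, hsc, hδ0, hδr, hδε, he, hb, hUb, hBb, hneb, hwind, hclass, hne, hεfr,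
      hεfz, hεfz', hWn, hH, hva, hva'⟩ := main ε hε
    rw [abs_of_neg (sub_neg.2 hxz)] at hεfz
    rw [abs_of_neg (sub_neg.2 hxz')] at hεfz'
    exact (arm_lines_at hsc hδ0 hδr he hb hUb hBb hneb γb hwind hclass hne hεfr hWn hH (habs hzr) (habs hz'r)
      hva hva').2 (by linarith) (by linarith)

/-- **The root wedge in the limit.**  For the winding class `j₀` hit frequently along the sequence
and the lattice wedge bound with constant `M_w` (the body of `RootWedgeBound` at these data):
`−M_w ≤ Re(conj ω · h z)` at every point `z` of the punctured closed half-disc of radius `r/4` at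
`x`, `ω = −e^{i(5/8)(π + 2πj₀)}` (a lattice site near `z` in the closed half-ball of radius `r/2`,
`wedge_at`, `site_value`, `ε → 0`). [cite: DuminilCopinSmirnov2012, §4 (the map H with dH = F dz)] -/
theorem wedge_limit {j₀ : ℤ}
    (hcl : ∃ᶠ n : ℕ in atTop, ∃ (ka kb j : ℤ)
      (γb : HexMidEdgeSAW (Λ (ns n)) (floorEdge ka (mr (ns n))) (floorEdge kb (m (ns n)))),
      e (ns n) = floorEdge ka (mr (ns n)) ∧ b (ns n) = floorEdge kb (m (ns n)) ∧
      upFace ka (mr (ns n)) ∈ Λ (ns n) ∧ belowFace ka (mr (ns n)) ∉ Λ (ns n) ∧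
      upFace kb (m (ns n)) ∈ Λ (ns n) ∧ belowFace kb (m (ns n)) ∉ Λ (ns n) ∧
      floorEdge kb (m (ns n)) ≠ floorEdge ka (mr (ns n)) ∧
      γb.winding = Real.pi + 2 * Real.pi * j ∧ (j : ZMod 8) = (j₀ : ZMod 8))
    {Mw : ℝ} (hMw : ∀ᶠ δ : ℝ in 𝓝[>] 0, ∀ H : Site 2 → ℂ, IsPotential (Λ δ) (e δ) H →
      ∀ (ub wb : HexVertex), b δ = s(ub, wb) →
      ∀ sb : Site 2, sb ∈ hexFaceVertices ub → sb ∈ hexFaceVertices wb →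
      ∀ v ∈ Λ δ, ∀ s ∈ hexFaceVertices v, (δ : ℂ) * triEmbed s ∈ Metric.closedBall x (r / 2) →
        δ * ((H s).re - (H sb).re) ≤
          Mw * ‖hexParafermionicObservable (Λ δ) (e δ) hexCriticalFugacity 0 (b δ)‖)
    {z : ℂ} (hz : z ∈ ({z : ℂ | x.im ≤ z.im} ∩ Metric.ball x (r / 4)) \ {x}) :
    -Mw ≤ ((starRingEnd ℂ) (-exp (I * (5 / 8 : ℂ) * ((Real.pi + 2 * Real.pi * j₀ : ℝ) : ℂ))) * h z).re := by
  obtain ⟨hr, hcarx, hevx, helim⟩ := hPR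
  obtain ⟨⟨hzim, hzb⟩, hzx⟩ := hz
  have hzx' : z ≠ x := hzx
  have hzr : ‖z - x‖ < r / 4 := by rwa [Metric.mem_ball, dist_eq_norm] at hzb
  have hzU : z ∈ (D.carrier ∪ (({z : ℂ | z.im = (D.pt 1).im} ∩ Metric.ball (D.pt 1) ρ) ∪
      ({z : ℂ | z.im = x.im} ∩ Metric.ball x r))) \ {x} := by
    refine ⟨?_, hzx⟩
    have hzb' : z ∈ Metric.ball x r := by rw [Metric.mem_ball, dist_eq_norm]; linarith
    rcases (show x.im ≤ z.im from hzim).lt_or_eq with hlt | heq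
    · exact Or.inl ((show z ∈ D.carrier ∩ Metric.ball x r by rw [hcarx]; exact ⟨hlt, hzb'⟩).1)
    · exact Or.inr (Or.inr ⟨heq.symm, hzb'⟩)
  refine le_of_forall_pos_lt_add fun ε hε => ?_
  obtain ⟨θ, hθ, hval⟩ := site_value hAF ⟨hr, hcarx, hevx, helim⟩ hx hSup hns hcont hconv hzU (half_pos hε)
  obtain ⟨-, -, -, -, -, -, -, -, hDS⟩ := local_data hAF ⟨hr, hcarx, hevx, helim⟩ hx hSup hzU
  have hbd := hevx.mono fun _ h => h.1
  obtain ⟨n, ⟨ka, kb, j, γb, he, hb, hUa, hBa, hUb, hBb, hneb, hwind, hclass⟩, hvn, ⟨s, hsl, hsz⟩, hMn, hsc,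
    hbdn, hδ0⟩ :=
    (hcl.and_eventually (hval.and ((hns.eventually (hDS (min θ (r / 4)) (lt_min hθ (by linarith)))).and
      ((hns.eventually hMw).and ((hns.eventually (hAF.2.2.1.mono fun _ h => h.1)).and
        ((hns.eventually hbd).and (hns.eventually (self_mem_nhdsWithin : Set.Ioi (0 : ℝ) ∈ 𝓝[>] 0)))))))).exists
  obtain ⟨H, hH⟩ := potentialExists_proof (Λ (ns n)) hsc (e (ns n)) hbdn
  have hb' : b (ns n) = s(belowFace kb (m (ns n)), upFace kb (m (ns n))) := hb
  have hsθ : ‖((ns n : ℝ) : ℂ) * triEmbed s - z‖ ≤ θ := hsz.le.trans (min_le_left _ _)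
  have hva := hvn H hH _ _ hb' _ (floorSite_mem_belowFace kb (m (ns n))) (floorSite_mem_upFace kb (m (ns n)))
    s hsl hsθ
  obtain ⟨v, hv, hsv⟩ := hsl
  have hball : ((ns n : ℝ) : ℂ) * triEmbed s ∈ Metric.closedBall x (r / 2) := by
    rw [Metric.mem_closedBall, dist_eq_norm]
    have := hsz.le.trans (min_le_right _ _)
    calc ‖((ns n : ℝ) : ℂ) * triEmbed s - x‖ ≤ ‖((ns n : ℝ) : ℂ) * triEmbed s - z‖ + ‖z - x‖ :=
          norm_sub_le_norm_sub_add_norm_sub _ _ _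
      _ ≤ r / 2 := by linarith
  have hM := hMn H hH _ _ hb' _ (floorSite_mem_belowFace kb (m (ns n))) (floorSite_mem_upFace kb (m (ns n)))
    v hv s hsv hball
  have := wedge_at hsc he hb hUa hBa hUb hBb hneb γb hwind hclass hM hva
  linarith

/-- **(I1)+(I2) of `pickEngine_stage2` for an engine limit** (radius `r₀ = r/4`): two straight arms
through one point `p` (east phase `θ = π/8 − (3/8)(π + 2πj₀)`, west phase `θ − π/4`, `j₀` the
winding class hit frequently along the sequence), the unimodular class direction
`ω = −e^{i(5/8)(π + 2πj₀)}` with the rigid compatibility `ω e^{−iθ} = e^{−iπ/8}`, and the wedge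
`−M ≤ Re(conj ω · h)` on the punctured closed half-disc, given the lattice wedge bound (the body of
`RootWedgeBound` at these data). [cite: DuminilCopinSmirnov2012, §4 (the map H with dH = F dz)] -/
theorem arms_wedge
    (hMw : ∃ Mw : ℝ, ∀ᶠ δ : ℝ in 𝓝[>] 0, ∀ H : Site 2 → ℂ, IsPotential (Λ δ) (e δ) H →
      ∀ (ub wb : HexVertex), b δ = s(ub, wb) →
      ∀ sb : Site 2, sb ∈ hexFaceVertices ub → sb ∈ hexFaceVertices wb →
      ∀ v ∈ Λ δ, ∀ s ∈ hexFaceVertices v, (δ : ℂ) * triEmbed s ∈ Metric.closedBall x (r / 2) →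
        δ * ((H s).re - (H sb).re) ≤
          Mw * ‖hexParafermionicObservable (Λ δ) (e δ) hexCriticalFugacity 0 (b δ)‖) :
    ∃ (p ω : ℂ) (θ M : ℝ),
      (∀ z ∈ Metric.ball x (r / 4), z.im = x.im → x.re < z.re →
        ∃ s : ℝ, h z = p + Complex.exp ((θ : ℂ) * Complex.I) * s) ∧
      (∀ z ∈ Metric.ball x (r / 4), z.im = x.im → z.re < x.re →
        ∃ s : ℝ, h z = p + Complex.exp (((θ - Real.pi / 4 : ℝ) : ℂ) * Complex.I) * s) ∧
      ‖ω‖ = 1 ∧ 0 < (ω * Complex.exp (-((θ : ℂ) * Complex.I))).re ∧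
      (ω * Complex.exp (-((θ : ℂ) * Complex.I))).im < (ω * Complex.exp (-((θ : ℂ) * Complex.I))).re ∧
      (∀ z ∈ ({z : ℂ | x.im ≤ z.im} ∩ Metric.ball x (r / 4)) \ {x}, -M ≤ ((starRingEnd ℂ) ω * h z).re) := by
  have hr := hPR.1
  obtain ⟨j₀, hcl⟩ := frequently_armClass hAF hPR hx hns
  obtain ⟨Mw, hMw⟩ := hMw
  obtain ⟨hωn, hω₁, hω₂⟩ := Engine.wedge_compat_of_rigid (Real.pi + 2 * Real.pi * j₀) j₀ rfl
  set θ : ℝ := Real.pi / 8 - 3 / 8 * (Real.pi + 2 * Real.pi * j₀) with hθ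
  set zE : ℂ := x + ((r / 8 : ℝ) : ℂ) with hzE
  set zW : ℂ := x - ((r / 8 : ℝ) : ℂ) with hzW
  have hzEim : zE.im = x.im := by rw [hzE]; simp
  have hzWim : zW.im = x.im := by rw [hzW]; simp
  have hzEre : zE.re = x.re + r / 8 := by rw [hzE]; simp
  have hzWre : zW.re = x.re - r / 8 := by rw [hzW]; simp
  have hzEr : ‖zE - x‖ < r / 2 := by
    rw [hzE, add_sub_cancel_left, Complex.norm_real, Real.norm_of_nonneg (by linarith)]; linarith
  have hzWr : ‖zW - x‖ < r / 2 := by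
    rw [hzW, sub_sub_cancel_left, norm_neg, Complex.norm_real, Real.norm_of_nonneg (by linarith)]; linarith
  obtain ⟨p, ⟨s₀, hs₀⟩, ⟨t₀, ht₀⟩⟩ := exists_two_lines (h zE) (h zW) θ
  refine ⟨p, _, θ, Mw, fun z hz hzim hxz => ?_, fun z hz hzim hzx => ?_, hωn, hω₁, hω₂,
    fun z hz => wedge_limit hAF hPR hx hSup hns hcont hconv hcl hMw hz⟩
  · have hzr : ‖z - x‖ < r / 2 := by rw [Metric.mem_ball, dist_eq_norm] at hz; linarith
    have key := (arm_lines hAF hPR hx hSup hns hcont hconv hcl hzim hzEim (ne_of_gt hxz) (by rw [hzEre]; linarith)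
      hzr hzEr).1 hxz (by rw [hzEre]; linarith)
    obtain ⟨s₁, hs₁⟩ := exists_real_of_im_eq_zero key
    refine ⟨s₀ + s₁, ?_⟩
    have : h z = (h z - h zE) + h zE := by ring
    rw [this, hs₁, hs₀, hθ]; push_cast; ring
  · have hzr : ‖z - x‖ < r / 2 := by rw [Metric.mem_ball, dist_eq_norm] at hz; linarith
    have key := (arm_lines hAF hPR hx hSup hns hcont hconv hcl hzim hzWim (ne_of_lt hzx) (by rw [hzWre]; linarith)
      hzr hzWr).2 hzx (by rw [hzWre]; linarith)
    obtain ⟨s₁, hs₁⟩ := exists_real_of_im_eq_zero key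
    refine ⟨t₀ + s₁, ?_⟩
    have : h z = (h z - h zW) + h zW := by ring
    rw [this, hs₁, ht₀, hθ]; push_cast; ring

end Frame

end Summit.CriticalPhenomena.SAWScalingLimit.Theorems.PickHalfPlane.BoundaryDataTransfer

end
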